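import Mathlib
import Summits.CriticalPhenomena.SAWScalingLimit.Theses.SAWLeftRightFKG
import Literature.Probability.RandomPlanarGeometry.SelfAvoidingWalkProofs

/-!
# Line `corner-localisation` — skeleton for crux `LeftRightFKG` (stmt-CriticalPhenomena-11232)

Route `route-CriticalPhenomena-SAWLeftRightFKG`, crux decl
`Summit.CriticalPhenomena.SAWScalingLimit.Theses.SAWLeftRightFKG.LeftRightFKG` (left–right positive
association of the critical square-lattice SAW chord in a simply connected lattice domain between
boundary-adjacent endpoints). Idea card `Cruxes/LeftRightFKG/Ideas/corner-localisation.md`, sharpened by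
`TRIAGE-r1-1.md`; line card `Lines/corner-localisation.md`.

## The line in one paragraph

Positive association (PA) is decided at the marked points. Work on the crux's OWN carrier
`SAW.DomainSAW Ω δ a b` (Ω = {wind(C) ≠ 0}, `a`, `b` adjacent to the boundary walk `C`) with the
fugacity-`x` chord measure `μx x` (`SAW.weight = μx x_c` by `rfl`), enlarged only by prescribing the set
`Sa` of allowed first steps and `Sb` of allowed last steps (`restr Sa Sb`) — the minimal class closed under
the induction (triage: shrink the carrier; no inhomogeneous edge weights, no holes). One graded statement
`PAfor x needFirst needLast` = the PA inequality `μ(A∩Γ)·μ(B∩Γ) ≤ μ(Γ)·μ(A∩B∩Γ)` (Γ = `restr Sa Sb`) for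
up-sets `A`, `B`, with `A` required to depend only on the FIRST step when `needFirst`, `B` only on the
LAST step when `needLast`:

* `Corner x   := PAfor x true  true`  — one corner covariance per instance (the 2×2 / merged minors
  `Z_{UV} Z_{UᶜVᶜ} ≥ Z_{UVᶜ} Z_{UᶜV}` of the refuter's first-to-fail family);
* `EndMono x  := PAfor x true false ∧ PAfor x false true` — ENDPOINT MONOTONICITY `μ(·|Eᶜ) ≼ μ(·|E)` for
  every up-set first-step event `E` (equivalently `Cov(1_E, 1_U) ≥ 0` for all up-sets `U`), and its mirror
  at `b`;
* `PA x       := PAfor x false false` — full positive association; at `Sa = Sb = univ`, `x = x_c` this is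
  LITERALLY the crux.

Chain (fugacity-blind, `x > 0` a parameter OUTSIDE the implication, so nothing is vacuous — triage defect
on `CornerY`/`PAY` answered): `Corner x → EndMono x` (mixture monotone in the weight + induction) and
`EndMono x → PA x` (two-point Chebyshev + induction), both by strong induction on `Σ_{γ∈Γ}(|γ|+1)` using
two geometric inputs stated as their own stubs: `StepMonotone` (first/last-step ranks are monotone in the
left–right order — the local winding jump at a boundary-adjacent endpoint; uses `Adj a a'`, `Adj b b'`,
which the refuter showed NECESSARY) and `DomainMarkov` (chords with a forced first step `s` ARE the chords
of the smaller crux instance from `s` with `a` spliced into the boundary walk — including the construction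
of a boundary walk `C''` whose LARGEST component is the right one). The `x ≤ x_c` content is isolated in
ONE stub, `stub_corner : Corner x_c` — the target the sibling line `kesten-loop-towers` attacks.

Stubs (sorried, registered; each stub's statement is a named `Prop`, aliased under the stub's own short name
in `Registered.*` so that the composition takes every stub BY NAME): `stub_stepMonotone : StepMonotone` (M/L),
`stub_domainMarkov : DomainMarkov` (L), `stub_endpointMonotone : CornerToEndMono` (M/L, the card's pivot),
`stub_chebyshev : EndMonoToPA` (M), `stub_corner : CornerCritical` (XL, hardest). Composition
`LeftRightFKG_of : Registered.stub_stepMonotone → Registered.stub_domainMarkov →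
Registered.stub_endpointMonotone → Registered.stub_chebyshev → Registered.stub_corner →
SAWLeftRightFKG.LeftRightFKG` (= `StepMonotone → DomainMarkov → CornerToEndMono → EndMonoToPA →
CornerCritical → LeftRightFKG` by `rfl`) is sorry-free (axioms propext / Classical.choice / Quot.sound); the
closing `example : LeftRightFKG` applies it to the five stubs by name.

Toy check of the skeleton's EXTRA exposure (restricted end-steps ⇒ individual and non-adjacent 2×2 minors of
the corner matrix at 3-direction endpoints), this session, `corner_restricted.py` (exact enumeration): every
pair of boundary-adjacent endpoints of the 5×5-, 6×5- and 6×6-vertex boxes (554 pairs) and 20 slit-tip /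
wall-midpoint cases up to 7×7 vertices — all minors of one common sign at `x_c ∈ [.3711, .3846]`
(0 violations; smallest relative margin 6·10⁻⁴, on the 7×7 box with two slit tips — a full 3×3 corner matrix), the pattern breaking only from `x ≈ .5` on
(supercritical), as DKY demands; the 7×6 / 7×7 / 8×7 all-pairs sweeps run as kit jobs j007834 / j007835
(results auto-attached to the crux item).

`Disproof.lean`: none exists for this crux at planning time (2026-08-16); honoured from the refuter's
crux attack: adjacency hypotheses are load-bearing (used in `stub_stepMonotone`), interior endpoints never
occur (every instance produced by `DomainMarkov` starts next to the new boundary point `a ∈ C''`).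
-/

noncomputable section

open MeasureTheory
open Literature.Probability.LatticeModels Literature.Probability.RandomPlanarGeometry
open scoped Classical ENNReal

namespace Summit.CriticalPhenomena.SAWScalingLimit.Cruxes.LeftRightFKG.CornerLocalisation

/-! ## Vocabulary — transparent names for the crux's own `let`-terms -/

/-- The crux's domain `Ω(C, δ) = {z | wind(δ-polyline of C, z) ≠ 0}`: verbatim the `let Ω` of
`SAWLeftRightFKG.LeftRightFKG`. [folklore] -/
def dom {c : Site 2} (C : (zdGraph 2).Walk c c) (δ : ℝ) : Set ℂ :=
  {z | Literature.Topology.PlaneTopology.wind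
    (fun t : ℝ => Set.IccExtend zero_le_one (C.toCurve (meshPoint δ)) t - z) ≠ 0}

/-- The crux's left–right order `γ₁ ≼ γ₂` (lens loop `γ₁ · γ₂⁻¹` has winding `≥ 0` everywhere):
verbatim its `let le`. [folklore] -/
def lr {Ω : Set ℂ} {δ : ℝ} {a b : Site 2} (γ₁ γ₂ : SAW.DomainSAW Ω δ a b) : Prop :=
  ∀ z : ℂ, 0 ≤ Literature.Topology.PlaneTopology.wind
    (fun t : ℝ => Set.IccExtend zero_le_one
      ((γ₁.walk.append γ₂.walk.reverse).toCurve (meshPoint δ)) t - z)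

/-- `A` is up-closed for `≼` (the crux's hypothesis on `A`, `B`). [folklore] -/
def IsUp {Ω : Set ℂ} {δ : ℝ} {a b : Site 2} (A : Set (SAW.DomainSAW Ω δ a b)) : Prop :=
  ∀ γ₁ γ₂, lr γ₁ γ₂ → γ₁ ∈ A → γ₂ ∈ A

/-- The first-step vertex `γ(1)` of a chord (`= a` for the trivial chord). [folklore] -/
def firstV {Ω : Set ℂ} {δ : ℝ} {a b : Site 2} (γ : SAW.DomainSAW Ω δ a b) : Site 2 :=
  γ.walk.getVert 1

/-- The last-step vertex `γ(|γ| - 1)` of a chord (`= b` for the trivial chord). [folklore] -/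
def lastV {Ω : Set ℂ} {δ : ℝ} {a b : Site 2} (γ : SAW.DomainSAW Ω δ a b) : Site 2 :=
  γ.walk.reverse.getVert 1

/-- `A` depends only on the first step. [folklore] -/
def FirstDet {Ω : Set ℂ} {δ : ℝ} {a b : Site 2} (A : Set (SAW.DomainSAW Ω δ a b)) : Prop :=
  ∀ γ₁ γ₂, firstV γ₁ = firstV γ₂ → (γ₁ ∈ A ↔ γ₂ ∈ A)

/-- `B` depends only on the last step. [folklore] -/
def LastDet {Ω : Set ℂ} {δ : ℝ} {a b : Site 2} (B : Set (SAW.DomainSAW Ω δ a b)) : Prop :=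
  ∀ γ₁ γ₂, lastV γ₁ = lastV γ₂ → (γ₁ ∈ B ↔ γ₂ ∈ B)

/-- Chords with prescribed first step in `Sa` and last step in `Sb` (the only enlargement of the
crux's class: it is what conditioning on corner events produces). `restr univ univ = univ`. [folklore] -/
def restr {Ω : Set ℂ} {δ : ℝ} {a b : Site 2} (Sa Sb : Set (Site 2)) :
    Set (SAW.DomainSAW Ω δ a b) :=
  {γ | firstV γ ∈ Sa ∧ lastV γ ∈ Sb}

/-- The fugacity-`x` chord measure `γ ↦ x^{|γ|}` (same shape as `SAW.weight`, which is the case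
`x = x_c`, by `rfl` — see the `example` below). [folklore] -/
def μx (x : ℝ) (Ω : Set ℂ) (δ : ℝ) (a b : Site 2) : Measure (SAW.DomainSAW Ω δ a b) :=
  Measure.sum fun γ => ENNReal.ofReal (x ^ γ.length) • Measure.dirac γ

/-- The crux's weight is the fugacity-`x_c` instance of `μx` — definitionally (this `rfl` is what lets the
composition below conclude the crux by `exact`). [folklore] -/
example (Ω : Set ℂ) (δ : ℝ) (a b : Site 2) :
    SAW.weight Ω δ a b = μx SAW.criticalFugacity Ω δ a b := rfl

/-- The crux's instance hypotheses: positive mesh, `a'`, `b'` on the boundary walk, `a ∼ a'`,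
`b ∼ b'`. [folklore] -/
def IsInst (δ : ℝ) {c : Site 2} (a b a' b' : Site 2) (C : (zdGraph 2).Walk c c) : Prop :=
  0 < δ ∧ a' ∈ C.support ∧ b' ∈ C.support ∧ (zdGraph 2).Adj a a' ∧ (zdGraph 2).Adj b b'

/-! ## The graded positive-association statement -/

/-- `PAfor x needFirst needLast`: for every crux instance, every end-step restriction `Γ = restr Sa Sb`
and all up-sets `A`, `B` — with `A` first-step-determined if `needFirst`, `B` last-step-determined if
`needLast` — the PA inequality `μ(A ∩ Γ) μ(B ∩ Γ) ≤ μ(Γ) μ(A ∩ B ∩ Γ)` for `μ = μx x`. -/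
def PAfor (x : ℝ) (needFirst needLast : Bool) : Prop :=
  ∀ (δ : ℝ) (c a b a' b' : Site 2) (C : (zdGraph 2).Walk c c), IsInst δ a b a' b' C →
    ∀ (Sa Sb : Set (Site 2)) (A B : Set (SAW.DomainSAW (dom C δ) δ a b)),
      IsUp A → IsUp B → (needFirst = true → FirstDet A) → (needLast = true → LastDet B) →
      μx x (dom C δ) δ a b (A ∩ restr Sa Sb) * μx x (dom C δ) δ a b (B ∩ restr Sa Sb) ≤
        μx x (dom C δ) δ a b (restr Sa Sb) * μx x (dom C δ) δ a b (A ∩ B ∩ restr Sa Sb)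

/-- CORNER POSITIVITY at fugacity `x`: `PAfor` for (first-step up-event, last-step up-event) only —
one bilinear inequality among four partition functions per instance. -/
abbrev Corner (x : ℝ) : Prop := PAfor x true true

/-- ENDPOINT MONOTONICITY at fugacity `x`: `PAfor` for (first-step up-event `E`, arbitrary up-set `U`)
— i.e. `P(U | E) ≥ P(U | Eᶜ)`, the up-set-wise domination `μ(·|Eᶜ) ≼ μ(·|E)` — and its mirror at `b`. -/
abbrev EndMono (x : ℝ) : Prop := PAfor x true false ∧ PAfor x false true

/-- FULL POSITIVE ASSOCIATION at fugacity `x` for all end-step restrictions; `Sa = Sb = univ`,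
`x = x_c` is the crux verbatim. -/
abbrev PA (x : ℝ) : Prop := PAfor x false false

/-! ## The two geometric inputs -/

/-- STEP-RANK MONOTONICITY (local planar topology at a boundary-adjacent endpoint) + finiteness:
for every crux instance the chord set is finite, and there are rankings of the lattice neighbours of
`a` (resp. `b`), injective on the neighbour set, such that the first-step (resp. last-step) rank is
monotone in `≼`. Content: the lens loop `γ₁ · γ₂⁻¹` leaves `a` along the first edge of `γ₁` and
returns along the first edge of `γ₂`; its winding number is `0` in the sector containing `a'`
(`a'` lies on the boundary trace, which reaches infinity avoiding the lens) and `±1` in the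
complementary sector, so `≼` forces a fixed cyclic order of (first edge of `γ₁`, first edge of `γ₂`)
seen from `a'` — the angular rank from `a'`. Uses `Adj a a'` / `Adj b b'` (necessary: interior
endpoints have no such ranking and PA fails there at every fugacity, refuter 2026-08-15).
[cite: Ahlfors1979, §4.2.1] -/
def StepMonotone : Prop :=
  ∀ (δ : ℝ) (c a b a' b' : Site 2) (C : (zdGraph 2).Walk c c), IsInst δ a b a' b' C →
    Finite (SAW.DomainSAW (dom C δ) δ a b) ∧
    (∃ r : Site 2 → ℕ, Set.InjOn r ((zdGraph 2).neighborSet a) ∧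
      ∀ γ₁ γ₂ : SAW.DomainSAW (dom C δ) δ a b, lr γ₁ γ₂ → r (firstV γ₁) ≤ r (firstV γ₂)) ∧
    (∃ r : Site 2 → ℕ, Set.InjOn r ((zdGraph 2).neighborSet b) ∧
      ∀ γ₁ γ₂ : SAW.DomainSAW (dom C δ) δ a b, lr γ₁ γ₂ → r (lastV γ₁) ≤ r (lastV γ₂))

/-- TWO-SIDED DOMAIN MARKOV PROPERTY on the crux's carrier: for a crux instance and a lattice
neighbour `s` of `a` that occurs as a first step, the chords with first step `s` are — via "drop the
first vertex" — exactly the chords of another crux instance `(C'', s, b)` with `a ∈ C''` (so `s` is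
boundary-adjacent) and `b' ∈ C''`, with the SAME left–right order; and the mirror statement at `b`.
Content: `C''` = `C` with the backtrack `a' → a → a'` spliced in, plus retraced tree-tours killing every
component of `{wind ≠ 0} ∖ {a}` that would otherwise out-size the component of `s` (the crux's
`DomainSAW` lives on the LARGEST component `meshDomain`); retraced additions do not change `wind` off
their trace; the reduced lens loop differs from the old one by the spur `[a, s]`, on which its winding
is `0` because `a` is now on the boundary trace. [folklore] -/
def DomainMarkov : Prop :=
  (∀ (δ : ℝ) (c a b a' b' : Site 2) (C : (zdGraph 2).Walk c c), IsInst δ a b a' b' C →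
    ∀ s : Site 2, (zdGraph 2).Adj a s →
      (∃ γ : SAW.DomainSAW (dom C δ) δ a b, firstV γ = s) →
      ∃ (c'' : Site 2) (C'' : (zdGraph 2).Walk c'' c''), a ∈ C''.support ∧ b' ∈ C''.support ∧
        ∃ e : {γ : SAW.DomainSAW (dom C δ) δ a b // firstV γ = s} ≃
            SAW.DomainSAW (dom C'' δ) δ s b,
          (∀ γ, (e γ).walk.support = γ.1.walk.support.tail) ∧
          (∀ γ₁ γ₂, lr γ₁.1 γ₂.1 ↔ lr (e γ₁) (e γ₂))) ∧
  (∀ (δ : ℝ) (c a b a' b' : Site 2) (C : (zdGraph 2).Walk c c), IsInst δ a b a' b' C →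
    ∀ t : Site 2, (zdGraph 2).Adj b t →
      (∃ γ : SAW.DomainSAW (dom C δ) δ a b, lastV γ = t) →
      ∃ (c'' : Site 2) (C'' : (zdGraph 2).Walk c'' c''), a' ∈ C''.support ∧ b ∈ C''.support ∧
        ∃ e : {γ : SAW.DomainSAW (dom C δ) δ a b // lastV γ = t} ≃
            SAW.DomainSAW (dom C'' δ) δ a t,
          (∀ γ, (e γ).walk.support = γ.1.walk.support.dropLast) ∧
          (∀ γ₁ γ₂, lr γ₁.1 γ₂.1 ↔ lr (e γ₁) (e γ₂)))

/-! ## The three analytic stub statements (named) -/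

/-- STATEMENT OF STUB 3 (the card's pivot; fugacity-blind): given the two geometric inputs, corner positivity
at fugacity `x` propagates to endpoint monotonicity at fugacity `x`, for every `x > 0`.
[cite: EsaryProschanWalkup1967] -/
def CornerToEndMono : Prop :=
  StepMonotone → DomainMarkov → ∀ x : ℝ, 0 < x → Corner x → EndMono x

/-- STATEMENT OF STUB 4 (Harris/CIS-type induction; fugacity-blind): given the two geometric inputs, one-ended
monotonicity at fugacity `x` propagates to full positive association at fugacity `x`, for every `x > 0`.
[cite: Harris1960] -/
def EndMonoToPA : Prop :=
  StepMonotone → DomainMarkov → ∀ x : ℝ, 0 < x → PAfor x true false → PA x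

/-- STATEMENT OF STUB 5 (the `x ≤ x_c` content; Transfer target `C⁺`): corner positivity AT `x_c` for every crux
instance and every end-step restriction. [cite: MadrasSlade1993, eq. (4.2.4)] -/
def CornerCritical : Prop :=
  Corner SAW.criticalFugacity

/-! ## Registered stubs -/

/-- STUB 1 (geometric input, M/L): step-rank monotonicity and finiteness, see `StepMonotone`. [cite: Ahlfors1979, §4.2.1] -/
theorem stub_stepMonotone : StepMonotone := by
  sorry

/-- STUB 2 (geometric input, L): the two-sided domain Markov property on the crux's carrier, see
`DomainMarkov`. [folklore] -/
theorem stub_domainMarkov : DomainMarkov := by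
  sorry

/-- STUB 3 (the card's pivot, M/L; fugacity-blind): corner positivity propagates to endpoint
monotonicity. For an up-set first-step event `E` and an up-set `U`, decompose `P(U | E)` and
`P(U | Eᶜ)` over an up-set last-step event `F` splitting `Γ`: the conditional terms compare by the
induction hypotheses (`PAfor · true false` for `Γ ∩ F`, `Γ ∩ Fᶜ`; `PAfor · false true` for `Γ ∩ E`),
and a two-member `≼`-increasing mixture is monotone in the mixing weight `P(F | E) ≥ P(F | Eᶜ)` =
`Corner`. If all chords of `Γ` share their last step, transport to the instance `(C'', a, t)` of
`DomainMarkov` (weights scale by `x`, order and first steps are preserved). Strong induction on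
`Σ_{γ ∈ Γ} (|γ| + 1)` over the finite chord set; `StepMonotone` supplies the splitting events. Both
conjuncts are proved simultaneously (the mirror argument swaps the roles of `a` and `b`). [cite: EsaryProschanWalkup1967] -/
theorem stub_endpointMonotone : CornerToEndMono := by
  sorry

/-- STUB 4 (Harris/CIS-type induction, M; fugacity-blind): endpoint monotonicity propagates to full
positive association. Split `Γ` by an up-set first-step event `E` (exists by `StepMonotone` whenever two
first steps occur): `μ(A)μ(B) ≤ μ(Γ)μ(A ∩ B)` follows from PA of `Γ ∩ E` and of `Γ ∩ Eᶜ` (induction)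
plus the cross terms `(P(A|E) − P(A|Eᶜ))(P(B|E) − P(B|Eᶜ)) ≥ 0` (two-point Chebyshev), both factors
being `≥ 0` by `PAfor x true false`. If all chords share their first step `s`, transport to the instance
`(C'', s, b)` of `DomainMarkov`. Strong induction on `Σ_{γ ∈ Γ} (|γ| + 1)`. [cite: Harris1960] -/
theorem stub_chebyshev : EndMonoToPA := by
  sorry

/-- STUB 5 (the `x ≤ x_c` content, XL — hardest): CORNER POSITIVITY AT `x_c` for every crux instance
and every end-step restriction: `Cov(first step ∈ up-interval, last step ∈ up-interval) ≥ 0`, i.e.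
`Z_{UV} Z_{UᶜVᶜ} ≥ Z_{UVᶜ} Z_{UᶜV}` for the `x_c`-weighted chord counts with prescribed end-edges.
Refuter data: thresholds `.644/.530/.486/.462/.447 → x_c⁺` on squares `L = 3..7`,
`Cov(x_c) ~ +C·L^{-3.35}`; triage: 0 violations on 1 287 perturbed instances; FALSE at `x = 1`
(3×3-vertex box, `36 > 24`) — the statement is at `x_c` only. Attacked by the sibling line
`kesten-loop-towers` (first-meeting double switching: `det = Σ_cores x^{|c|} Σ_k (−1)^k E_k(c) + R`). [cite: MadrasSlade1993, eq. (4.2.4)] -/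
theorem stub_corner : CornerCritical := by
  sorry

/-! ## Name-keyed aliases of the five statements (hypotheses of the composition)

`Registered.stub_X` is the statement of `stub_X` under the registered stub's short name, so that the
native skeleton audit (`#h21_check_skeleton`: hypotheses admissible iff registered obligations / declared
stubs BY NAME) accepts `LeftRightFKG_of : Registered.stub_stepMonotone → … → LeftRightFKG` (device of
`CardyFormulaZ2/Cruxes/LagHandOff/Lines/crosscut-dictionary.lean` and
`BoseEinsteinCondensation/Cruxes/GroundStateStability/Lines/six-vertex-euler-gates.lean`). -/
namespace Registered

/-- Alias of `StepMonotone` keyed by the registered stub name. [folklore] -/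
abbrev stub_stepMonotone : Prop := StepMonotone
/-- Alias of `DomainMarkov` keyed by the registered stub name. [folklore] -/
abbrev stub_domainMarkov : Prop := DomainMarkov
/-- Alias of `CornerToEndMono` keyed by the registered stub name. [folklore] -/
abbrev stub_endpointMonotone : Prop := CornerToEndMono
/-- Alias of `EndMonoToPA` keyed by the registered stub name. [folklore] -/
abbrev stub_chebyshev : Prop := EndMonoToPA
/-- Alias of `CornerCritical` keyed by the registered stub name. [folklore] -/
abbrev stub_corner : Prop := CornerCritical

end Registered

/-! ## Composition (kernel-checked, no `sorry`) -/

/-- `restr univ univ` is everything. [folklore] -/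
theorem restr_univ_univ {Ω : Set ℂ} {δ : ℝ} {a b : Site 2} :
    (restr Set.univ Set.univ : Set (SAW.DomainSAW Ω δ a b)) = Set.univ := by
  ext γ; simp [restr]

/-- `PA x_c` contains the crux's inequality: end-step restriction `Sa = Sb = univ`, stated over
`dom C δ` (definitionally the crux's `let Ω`). [folklore] -/
theorem weight_ineq_of_PA (h : PA SAW.criticalFugacity) (δ : ℝ) (c a b a' b' : Site 2)
    (C : (zdGraph 2).Walk c c) (hδ : 0 < δ) (ha' : a' ∈ C.support) (hb' : b' ∈ C.support)
    (haa' : (zdGraph 2).Adj a a') (hbb' : (zdGraph 2).Adj b b')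
    (A B : Set (SAW.DomainSAW (dom C δ) δ a b)) (hA : IsUp A) (hB : IsUp B) :
    μx SAW.criticalFugacity (dom C δ) δ a b A * μx SAW.criticalFugacity (dom C δ) δ a b B ≤
      μx SAW.criticalFugacity (dom C δ) δ a b Set.univ *
        μx SAW.criticalFugacity (dom C δ) δ a b (A ∩ B) := by
  have key := h δ c a b a' b' C ⟨hδ, ha', hb', haa', hbb'⟩ Set.univ Set.univ A B hA hB
    (fun h => absurd h Bool.false_ne_true) (fun h => absurd h Bool.false_ne_true)
  simpa only [restr_univ_univ, Set.inter_univ] using key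

/-- THE LINE: the five stub statements (keyed by the stubs' names) imply the crux BY NAME.
`PA x_c` at `Sa = Sb = univ` is the crux after
`restr univ univ = univ` and `SAW.weight = μx x_c` (definitional); `0 < x_c` is the tree's hypothesis-free
`SAW.criticalFugacity_pos_lt_one'`. [folklore] -/
theorem LeftRightFKG_of (h₁ : Registered.stub_stepMonotone) (h₂ : Registered.stub_domainMarkov)
    (h₃ : Registered.stub_endpointMonotone) (h₄ : Registered.stub_chebyshev)
    (h₅ : Registered.stub_corner) :
    Summit.CriticalPhenomena.SAWScalingLimit.Theses.SAWLeftRightFKG.LeftRightFKG := by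
  have hx : 0 < SAW.criticalFugacity := SAW.criticalFugacity_pos_lt_one'.1
  have hPA : PA SAW.criticalFugacity := h₄ h₁ h₂ _ hx (h₃ h₁ h₂ _ hx h₅).1
  intro δ c a b a' b' C Ω le hδ ha' hb' haa' hbb' A B hA hB
  exact weight_ineq_of_PA hPA δ c a b a' b' C hδ ha' hb' haa' hbb' A B hA hB

/-- WIRING CHECK: the five registered stubs feed `LeftRightFKG_of` as stated (an `example`, so that
`LeftRightFKG_of` stays the only theorem concluding the crux). -/
example : Summit.CriticalPhenomena.SAWScalingLimit.Theses.SAWLeftRightFKG.LeftRightFKG :=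
  LeftRightFKG_of stub_stepMonotone stub_domainMarkov stub_endpointMonotone stub_chebyshev
    stub_corner

end Summit.CriticalPhenomena.SAWScalingLimit.Cruxes.LeftRightFKG.CornerLocalisation

end
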